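import Summits.Ventures.PercRepro.RLSRuleLinePointT1
import Summits.Ventures.PercRepro.RLSRuleTypeTools

/-!
# C-025 at q = 3: tools for the `5`-point planes at `t ≥ 1` (night-3, gen 4)

Generic pieces of the `t = 1` / `t = 2` accountings of the two `5`-point `𝒯₀` planes with a `3`-point line
(`RLSRuleTwoLinesT1*`, `RLSRuleOneLineFive*`), on a plane `G` with an independent `K ⊆ E ∖ G`:

* the WITNESS SUMS with `|K| = n + 3` (`t = 1`): `sum_filter_subset_witnessFamily_t1` (the witnesses through a fixed
  triple, `Σ_{j<n−2} C(n, j) g(j+3)`), `sum_witness_eq_t1z2`, `sum_good_four_t1` (a lined `4`-set on its good witnesses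
  pays `3(t1z1 − lost4)`), `sum_good_both_t1_ge` (the plane on the witnesses avoiding two triples pays
  `≥ 8(t1z2 − 2·lost5)`, union bound);
* the DEMAND: `card_add_le_of_mem_UqG` (a bottom set misses `t` points of `G` when `ρ(E ∖ G) + t ≤ p`),
  `card_UqG_le_of_line_subset_closure` — the REFINED demand on a `5`-point plane with a `3`-point line `ℓ` inside
  `cl(E ∖ G)`: every bottom set is `A ∪ {b}` with `A ⊆ ℓ`, `|A| ≥ 2`, `b ∈ G ∖ ℓ` (at most `8`);
* the `4`-subsets through a `3`-point line: `filter_four_line_eq_image`, `card_filter_four_line` (exactly `2` on a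
  `5`-point plane); `not_indep_of_eRk_two_card_three`.
Imports `RLSRuleLinePointT1`, `RLSRuleTypeTools`.  Axioms: standard.
-/

open scoped Matroid

namespace PercRepro

namespace NightThree

open Finset ThmH PerFlat

variable {α : Type*} [DecidableEq α] {M : Matroid α} [M.Finite]

omit [DecidableEq α] [M.Finite] in
/-- A `3`-point set of rank `2` is dependent. -/
theorem not_indep_of_eRk_two_card_three {ℓ : Finset α} (hℓr : M.eRk (ℓ : Set α) = 2) (hℓc : ℓ.card = 3) :
    ¬ M.Indep (ℓ : Set α) := by
  intro hi
  have := eRk_eq_card_of_indep hi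
  rw [hℓr, hℓc] at this
  exact absurd this (by decide)

/-! ### The witness sums at `t = 1` (`|K| = n + 3`) -/

omit [M.Finite] in
/-- The supersets of a fixed `3`-subset `C` of `K` (`|K| = n + 3`) in the witness family, weighted by a function of the
size: `Σ_{j < n − 2} C(n, j) · g(j + 3)`. -/
theorem sum_filter_subset_witnessFamily_t1 {K C : Finset α} {n : ℕ} (hn : 2 ≤ n) (hK : K.card = n + 3) (hC : C ⊆ K)
    (hCc : C.card = 3) (g : ℕ → ℚ) :
    ∑ X ∈ (witnessFamily K n).filter (fun X => C ⊆ X), g X.card =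
      ∑ j ∈ range (n - 2), (n.choose j : ℚ) * g (j + 3) := by
  classical
  unfold witnessFamily
  rw [Finset.filter_biUnion, Finset.sum_biUnion]
  · have hinner : ∀ x ∈ Finset.Ico 1 (n + 1),
        ∑ X ∈ (K.powersetCard x).filter (fun X => C ⊆ X), g X.card =
          if 3 ≤ x then (n.choose (x - 3) : ℚ) * g x else 0 := by
      intro x _
      rw [Finset.sum_congr rfl (fun X hX => by
        rw [(Finset.mem_powersetCard.1 (Finset.mem_filter.1 hX).1).2]), Finset.sum_const, nsmul_eq_mul]
      by_cases h3 : 3 ≤ x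
      · rw [if_pos h3, card_filter_subset_powersetCard hC hCc h3, hK, show n + 3 - 3 = n by omega]
      · rw [if_neg h3]
        have : ((K.powersetCard x).filter (fun X => C ⊆ X)) = ∅ := by
          rw [Finset.eq_empty_iff_forall_notMem]
          intro X hX
          rw [Finset.mem_filter, Finset.mem_powersetCard] at hX
          have := Finset.card_le_card hX.2
          omega
        rw [this, Finset.card_empty, Nat.cast_zero, zero_mul]
    rw [Finset.sum_congr rfl hinner]
    rw [← Finset.sum_Ico_consecutive _ (show 1 ≤ 3 by norm_num) (show 3 ≤ n + 1 by omega)]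
    have hz : ∑ x ∈ Finset.Ico 1 3, (if 3 ≤ x then (n.choose (x - 3) : ℚ) * g x else 0) = 0 := by
      apply Finset.sum_eq_zero
      intro x hx
      rw [Finset.mem_Ico] at hx
      rw [if_neg (by omega)]
    rw [hz, zero_add, Finset.sum_Ico_eq_sum_range, show n + 1 - 3 = n - 2 by omega]
    apply Finset.sum_congr rfl
    intro j _
    rw [if_pos (by omega), show 3 + j - 3 = j by omega, add_comm 3 j]
  · exact (K.pairwise_disjoint_powersetCard.set_pairwise _).mono' (fun x y h => by
      exact Finset.disjoint_filter_filter h)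

omit [M.Finite] in
/-- The `5`-set share with `|K| = n + 3` sums to `8·t1z2Sum n`. -/
theorem sum_witness_eq_t1z2 {K : Finset α} {n : ℕ} (hK : K.card = n + 3) :
    ∑ X ∈ witnessFamily K n, 8 / (((5 + X.card).choose 3 : ℕ) : ℚ) = 8 * W1.t1z2Sum n := by
  classical
  rw [sum_witnessFamily K n (fun x => 8 / (((5 + x).choose 3 : ℕ) : ℚ)), hK]
  unfold W1.t1z2Sum
  rw [Finset.mul_sum]
  apply Finset.sum_congr rfl
  intro i _
  rw [show 5 + (i + 1) = i + 6 by omega]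
  ring

omit [M.Finite] in
/-- The good witnesses of a `4`-set through a line pay `3(t1z1 − lost4)` at `t = 1`. -/
theorem sum_good_four_t1 {K C : Finset α} {n : ℕ} (hn : 2 ≤ n) (hK : K.card = n + 3) (hC : C ⊆ K)
    (hCc : C.card = 3) :
    ∑ X ∈ (witnessFamily K n).filter (fun X => ¬ C ⊆ X), 3 / (((4 + X.card).choose 3 : ℕ) : ℚ) =
      3 * W1.t1z1Sum n - 3 * W1.t1lost4Sum n := by
  classical
  have hfull := sum_witness_eq_t1z1 hK
  have hlost : ∑ X ∈ (witnessFamily K n).filter (fun X => C ⊆ X), 3 / (((4 + X.card).choose 3 : ℕ) : ℚ) =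
      3 * W1.t1lost4Sum n := by
    rw [sum_filter_subset_witnessFamily_t1 hn hK hC hCc (fun x => 3 / (((4 + x).choose 3 : ℕ) : ℚ))]
    unfold W1.t1lost4Sum
    rw [Finset.mul_sum]
    apply Finset.sum_congr rfl
    intro j _
    rw [show 4 + (j + 3) = j + 7 by omega]
    ring
  have hsplit := Finset.sum_filter_add_sum_filter_not (witnessFamily K n) (fun X => C ⊆ X)
    (fun X => 3 / (((4 + X.card).choose 3 : ℕ) : ℚ))
  linarith

omit [M.Finite] in
/-- The witnesses containing neither of two `3`-subsets `C`, `C′` of `K` pay at least `8(t1z2 − 2·lost5)` at `t = 1`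
(union bound). -/
theorem sum_good_both_t1_ge {K C C' : Finset α} {n : ℕ} (hn : 2 ≤ n) (hK : K.card = n + 3) (hC : C ⊆ K)
    (hCc : C.card = 3) (hC' : C' ⊆ K) (hC'c : C'.card = 3) :
    8 * W1.t1z2Sum n - 16 * W1.t1lost5Sum n ≤
      ∑ X ∈ (witnessFamily K n).filter (fun X => ¬ C ⊆ X ∧ ¬ C' ⊆ X), 8 / (((5 + X.card).choose 3 : ℕ) : ℚ) := by
  classical
  set f : Finset α → ℚ := fun X => 8 / (((5 + X.card).choose 3 : ℕ) : ℚ) with hf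
  have hfnn : ∀ X, 0 ≤ f X := fun X => by rw [hf]; positivity
  have hfull : ∑ X ∈ witnessFamily K n, f X = 8 * W1.t1z2Sum n := sum_witness_eq_t1z2 hK
  have hlost : ∀ D ⊆ K, D.card = 3 →
      ∑ X ∈ (witnessFamily K n).filter (fun X => D ⊆ X), f X = 8 * W1.t1lost5Sum n := by
    intro D hD hDc
    rw [hf, sum_filter_subset_witnessFamily_t1 hn hK hD hDc (fun x => 8 / (((5 + x).choose 3 : ℕ) : ℚ))]
    unfold W1.t1lost5Sum
    rw [Finset.mul_sum]
    apply Finset.sum_congr rfl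
    intro j _
    rw [show 5 + (j + 3) = j + 8 by omega]
    ring
  have hbad : ∑ X ∈ (witnessFamily K n).filter (fun X => ¬ (¬ C ⊆ X ∧ ¬ C' ⊆ X)), f X ≤
      16 * W1.t1lost5Sum n := by
    have hfilt : (witnessFamily K n).filter (fun X => ¬ (¬ C ⊆ X ∧ ¬ C' ⊆ X)) =
        (witnessFamily K n).filter (fun X => C ⊆ X) ∪ (witnessFamily K n).filter (fun X => C' ⊆ X) := by
      ext X
      rw [Finset.mem_union, Finset.mem_filter, Finset.mem_filter, Finset.mem_filter]
      tauto
    rw [hfilt]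
    have h1 := Finset.sum_union_inter (s₁ := (witnessFamily K n).filter (fun X => C ⊆ X))
      (s₂ := (witnessFamily K n).filter (fun X => C' ⊆ X)) (f := f)
    have h2 : 0 ≤ ∑ X ∈ (witnessFamily K n).filter (fun X => C ⊆ X) ∩ (witnessFamily K n).filter (fun X => C' ⊆ X),
        f X := Finset.sum_nonneg (fun X _ => hfnn X)
    rw [hlost C hC hCc, hlost C' hC' hC'c] at h1
    linarith
  have hsplit := Finset.sum_filter_add_sum_filter_not (witnessFamily K n) (fun X => ¬ C ⊆ X ∧ ¬ C' ⊆ X) f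
  linarith

/-! ### The demand at `t ≥ 1` -/

/-- A bottom set `B′ ⊆ G` at `(p, 3)` misses `t` points of `G` when `ρ(E ∖ G) + t ≤ p`. -/
theorem card_add_le_of_mem_UqG {G B : Finset α} {p t e : ℕ} (hB : B ∈ UqG M p 3 G)
    (he : M.eRk ((gr M \ G : Finset α) : Set α) = e) (het : e + t ≤ p) : B.card + t ≤ G.card := by
  unfold UqG at hB
  rw [Finset.mem_filter, mem_Uq] at hB
  obtain ⟨⟨_, _, hBp⟩, hBG⟩ := hB
  have h1 := eRk_sdiff_le_add M G B (gr M)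
  rw [hBp, he] at h1
  have h2 : M.eRk ((G \ B : Finset α) : Set α) ≤ ((G \ B).card : ℕ∞) := by
    have := M.eRk_le_encard ((G \ B : Finset α) : Set α)
    rwa [Set.encard_coe_eq_coe_finsetCard] at this
  have h3 : (p : ℕ∞) ≤ (((G \ B).card + e : ℕ) : ℕ∞) := by
    have := h1.trans (add_le_add h2 le_rfl)
    exact_mod_cast this
  have h4 : p ≤ (G \ B).card + e := by exact_mod_cast h3
  have h5 := Finset.card_sdiff_add_card_eq_card hBG
  omega

omit [DecidableEq α] [M.Finite] in
/-- `ℓ.powerset.filter (2 ≤ card)` has `4` members when `|ℓ| = 3`. -/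
theorem card_powerset_filter_two_le {ℓ : Finset α} (hℓc : ℓ.card = 3) :
    (ℓ.powerset.filter (fun A => 2 ≤ A.card)).card = 4 := by
  classical
  have h := Finset.card_filter (fun A : Finset α => 2 ≤ A.card) ℓ.powerset
  rw [h, Finset.sum_powerset_apply_card (fun b => if 2 ≤ b then 1 else 0), hℓc]
  norm_num [Finset.sum_range_succ, Nat.choose]

/-- **The refined demand with a line in the hyperplane.**  On a `5`-point plane `G` with a `3`-point line `ℓ ⊆ cl(E ∖ G)`
and `ρ(E ∖ G) < p`, every bottom set is `A ∪ {b}` with `A ⊆ ℓ`, `|A| ≥ 2`, `b ∈ G ∖ ℓ`: at most `8` of them. -/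
theorem card_UqG_le_of_line_subset_closure {G ℓ : Finset α} {p : ℕ} (hℓG : ℓ ⊆ G) (hℓc : ℓ.card = 3)
    (hℓr : M.eRk (ℓ : Set α) = 2) (hGc : G.card = 5)
    (hsub : (ℓ : Set α) ⊆ M.closure ((gr M \ G : Finset α) : Set α))
    (hlt : M.eRk ((gr M \ G : Finset α) : Set α) < (p : ℕ∞)) : (UqG M p 3 G).card ≤ 8 := by
  classical
  set D := G \ ℓ with hD
  have hDc : D.card = 2 := by rw [hD, Finset.card_sdiff_of_subset hℓG, hGc, hℓc]
  have hsub' : UqG M p 3 G ⊆ ((ℓ.powerset.filter (fun A => 2 ≤ A.card)) ×ˢ D).image (fun q => insert q.2 q.1) := by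
    intro B hB
    have hnot := not_subset_closure_of_mem_UqG hB hlt
    have hB' := hB
    unfold UqG at hB'
    rw [Finset.mem_filter, mem_Uq] at hB'
    obtain ⟨⟨_, hB3, _⟩, hBG⟩ := hB'
    have hB3' : M.eRk (B : Set α) = 3 := by exact_mod_cast hB3
    have hBc : 3 ≤ B.card := three_le_card_of_eRk_eq_three hB3'
    -- a point `b ∈ D` outside `B′`
    obtain ⟨b, hbD, hbB⟩ : ∃ b ∈ D, b ∉ B := by
      by_contra hc
      push Not at hc
      apply hnot
      intro x hx
      rw [Finset.coe_sdiff] at hx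
      obtain ⟨hxG, hxB⟩ := hx
      have hxℓ : x ∈ ℓ := by
        by_contra hxℓ
        exact hxB (hc x (by rw [hD, Finset.mem_sdiff]; exact ⟨Finset.mem_coe.1 hxG, hxℓ⟩))
      exact hsub (Finset.mem_coe.2 hxℓ)
    -- a point `b′ ∈ B′ ∩ D` (else `B′ ⊆ ℓ` has rank `≤ 2`)
    obtain ⟨b', hb'B, hb'D⟩ : ∃ b' ∈ B, b' ∈ D := by
      by_contra hc
      push Not at hc
      have hBℓ : B ⊆ ℓ := by
        intro x hx
        by_contra hxℓ
        exact hc x hx (by rw [hD, Finset.mem_sdiff]; exact ⟨hBG hx, hxℓ⟩)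
      have := M.eRk_mono (Finset.coe_subset.2 hBℓ)
      rw [hB3', hℓr] at this
      exact absurd this (by decide)
    have hbb' : b ≠ b' := fun h => hbB (h ▸ hb'B)
    have hDeq : D = {b, b'} := by
      symm
      apply Finset.eq_of_subset_of_card_le
      · intro x hx
        rw [Finset.mem_insert, Finset.mem_singleton] at hx
        rcases hx with rfl | rfl
        · exact hbD
        · exact hb'D
      · rw [hDc, Finset.card_pair hbb']
    rw [Finset.mem_image]
    refine ⟨(B ∩ ℓ, b'), ?_, ?_⟩
    · rw [Finset.mem_product, Finset.mem_filter, Finset.mem_powerset]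
      refine ⟨⟨Finset.inter_subset_right, ?_⟩, hb'D⟩
      show 2 ≤ (B ∩ ℓ).card
      -- `B′ = (B′ ∩ ℓ) ∪ {b′}`, so `|B′ ∩ ℓ| = |B′| − 1 ≥ 2`
      have hBeq : B = insert b' (B ∩ ℓ) := by
        ext x
        rw [Finset.mem_insert, Finset.mem_inter]
        constructor
        · intro hx
          by_cases hxℓ : x ∈ ℓ
          · exact Or.inr ⟨hx, hxℓ⟩
          · left
            have hxD : x ∈ D := by rw [hD, Finset.mem_sdiff]; exact ⟨hBG hx, hxℓ⟩
            rw [hDeq, Finset.mem_insert, Finset.mem_singleton] at hxD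
            rcases hxD with rfl | rfl
            · exact absurd hx hbB
            · rfl
        · rintro (rfl | ⟨hx, _⟩)
          · exact hb'B
          · exact hx
      have hb'notin : b' ∉ B ∩ ℓ := by
        rw [Finset.mem_inter]
        rintro ⟨_, hb'ℓ⟩
        rw [hD, Finset.mem_sdiff] at hb'D
        exact hb'D.2 hb'ℓ
      have := Finset.card_insert_of_notMem hb'notin
      rw [← hBeq] at this
      omega
    · dsimp only
      ext x
      rw [Finset.mem_insert, Finset.mem_inter]
      constructor
      · rintro (rfl | ⟨hx, _⟩)
        · exact hb'B
        · exact hx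
      · intro hx
        by_cases hxℓ : x ∈ ℓ
        · exact Or.inr ⟨hx, hxℓ⟩
        · left
          have hxD : x ∈ D := by rw [hD, Finset.mem_sdiff]; exact ⟨hBG hx, hxℓ⟩
          rw [hDeq, Finset.mem_insert, Finset.mem_singleton] at hxD
          rcases hxD with rfl | rfl
          · exact absurd hx hbB
          · rfl
  calc (UqG M p 3 G).card ≤ (((ℓ.powerset.filter (fun A => 2 ≤ A.card)) ×ˢ D).image (fun q => insert q.2 q.1)).card :=
        Finset.card_le_card hsub'
    _ ≤ ((ℓ.powerset.filter (fun A => 2 ≤ A.card)) ×ˢ D).card := Finset.card_image_le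
    _ = 8 := by rw [Finset.card_product, card_powerset_filter_two_le hℓc, hDc]

/-! ### The `4`-subsets through a line -/

omit [M.Finite] in
/-- The `4`-subsets of `G` through a `3`-point line `ℓ ⊆ G` are the sets `ℓ ∪ {b}`, `b ∈ G ∖ ℓ`. -/
theorem filter_four_line_eq_image {G ℓ : Finset α} (hℓG : ℓ ⊆ G) (hℓc : ℓ.card = 3) :
    (G.powersetCard 4).filter (fun B => ℓ ⊆ B) = (G \ ℓ).image (fun b => insert b ℓ) := by
  classical
  ext B
  rw [Finset.mem_filter, Finset.mem_powersetCard, Finset.mem_image]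
  constructor
  · rintro ⟨⟨hBG, hBc⟩, hℓB⟩
    obtain ⟨b, hb⟩ : ∃ b, B \ ℓ = {b} := by
      apply Finset.card_eq_one.1
      rw [Finset.card_sdiff_of_subset hℓB, hBc, hℓc]
    have hbB : b ∈ B \ ℓ := by rw [hb]; exact Finset.mem_singleton_self b
    rw [Finset.mem_sdiff] at hbB
    refine ⟨b, by rw [Finset.mem_sdiff]; exact ⟨hBG hbB.1, hbB.2⟩, ?_⟩
    ext x
    rw [Finset.mem_insert]
    constructor
    · rintro (rfl | hx)
      · exact hbB.1
      · exact hℓB hx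
    · intro hx
      by_cases hxℓ : x ∈ ℓ
      · exact Or.inr hxℓ
      · left
        have : x ∈ B \ ℓ := Finset.mem_sdiff.2 ⟨hx, hxℓ⟩
        rw [hb, Finset.mem_singleton] at this
        exact this
  · rintro ⟨b, hb, rfl⟩
    rw [Finset.mem_sdiff] at hb
    refine ⟨⟨Finset.insert_subset hb.1 hℓG, ?_⟩, Finset.subset_insert _ _⟩
    rw [Finset.card_insert_of_notMem hb.2, hℓc]

omit [M.Finite] in
/-- On a `5`-point plane there are exactly `2` four-subsets through a `3`-point line. -/
theorem card_filter_four_line {G ℓ : Finset α} (hℓG : ℓ ⊆ G) (hℓc : ℓ.card = 3) (hGc : G.card = 5) :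
    ((G.powersetCard 4).filter (fun B => ℓ ⊆ B)).card = 2 := by
  classical
  rw [filter_four_line_eq_image hℓG hℓc, Finset.card_image_of_injOn, Finset.card_sdiff_of_subset hℓG, hGc, hℓc]
  intro b hb b' hb' h
  rw [Finset.mem_coe, Finset.mem_sdiff] at hb hb'
  dsimp only at h
  have : b ∈ insert b' ℓ := by rw [← h]; exact Finset.mem_insert_self _ _
  rw [Finset.mem_insert] at this
  rcases this with h1 | h1
  · exact h1
  · exact absurd h1 hb.2

end NightThree

end PercRepro
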